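import Summits.Ventures.HodgeRepro.TwistedQuadGen

/-!
# Route-2's Theorems T and S beyond degree 24: `k = 8` (degree 32) and `k = 12` (degree 48) on the kernel

Blind re-derivation cell `pub-hodge-repro`, seat `p1` (gen 12).  ROUTE-B §9.42's OPEN list notes that route-2's
degree-32 predictions of Theorems T / S were never enumerated.  With the parametric models of `TwistedQuadGen.lean`
they are cheap to decide: (T, `k = 8`) on `ℤ/16 ⋊ ℤ/2`, both signs (`u v u⁻¹ = v⁷ = c v⁻¹` and `v⁹ = c v`): the
seat's enumeration (proofs/p1-g12/tswitness_k8_k12.py, all 65,536 CM types of each model) finds 32 instances per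
pointed `Δ_T` and sign — route-2's (T4) `2^{k/2+1} = 32` exactly; (S, `k = 12`) on `ℤ/24 ⋊ ℤ/2`, both forms
(`SD`: `u v u⁻¹ = v¹¹`, `w = u`; `M`: `u v u⁻¹ = v¹³`, `w = v⁷ u` with `w² = v²`, `w v w⁻¹ = c v`): route-2's period-8
word `00101101` with `b_i = 2 − A(i)` (resp. `2 − A(i + 2)`) gives the 8 types of (S2), checked to be `SumTwo`
without a conjugate pair (proofs/p1-g12/segwitness_k12.py).  This file puts one instance of each on the kernel for
every ambient `(G, c)` (`exists_twistedRectQuad_k8_neg` / `_pos`, `exists_segmentQuad_k12_SD` / `_M`), with the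
instances on the models themselves; the local conditions are DECIDED on 32 resp. 48 elements.
-/

set_option autoImplicit false

open Finset Multiplicative
open scoped Pointwise

namespace HodgeRepro.TwistedQuadGen

open HodgeRepro.CosetQuad

/-! ### `k = 8`: the twisted rectangle of degree 32 -/

/-- `7² = 1` in `ℤ/16`. -/
theorem seven_sq_sixteen : (7 : ZMod 16) * 7 = 1 := by decide

/-- `9² = 1` in `ℤ/16`. -/
theorem nine_sq_sixteen : (9 : ZMod 16) * 9 = 1 := by decide

/-- `(7 : ℤ/16).val = 7`. -/
theorem val_seven_sixteen : (7 : ZMod 16).val = 7 := by decide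

/-- `(9 : ℤ/16).val = 9`. -/
theorem val_nine_sixteen : (9 : ZMod 16).val = 9 := by decide

/-- A twisted-rectangle instance on `ℤ/16 ⋊ ℤ/2`, `ε = −` (coordinates `(n, g) ↦ vⁿ uᵍ`). -/
def rect8neg : Finset (TwistGroup 16 7 seven_sq_sixteen) :=
  {⟨ofAdd 0, ofAdd 0⟩, ⟨ofAdd 0, ofAdd 1⟩, ⟨ofAdd 1, ofAdd 1⟩, ⟨ofAdd 2, ofAdd 0⟩, ⟨ofAdd 2, ofAdd 1⟩, ⟨ofAdd
  3, ofAdd 1⟩, ⟨ofAdd 4, ofAdd 0⟩, ⟨ofAdd 4, ofAdd 1⟩, ⟨ofAdd 5, ofAdd 1⟩, ⟨ofAdd 6, ofAdd 1⟩, ⟨ofAdd 7, ofAdd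
  0⟩, ⟨ofAdd 9, ofAdd 0⟩, ⟨ofAdd 11, ofAdd 0⟩, ⟨ofAdd 13, ofAdd 0⟩, ⟨ofAdd 14, ofAdd 0⟩, ⟨ofAdd 15, ofAdd 1⟩}

/-- A twisted-rectangle instance on `ℤ/16 ⋊ ℤ/2`, `ε = +`. -/
def rect8pos : Finset (TwistGroup 16 9 nine_sq_sixteen) :=
  {⟨ofAdd 0, ofAdd 0⟩, ⟨ofAdd 0, ofAdd 1⟩, ⟨ofAdd 1, ofAdd 0⟩, ⟨ofAdd 3, ofAdd 0⟩, ⟨ofAdd 5, ofAdd 0⟩, ⟨ofAdd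
  7, ofAdd 0⟩, ⟨ofAdd 9, ofAdd 1⟩, ⟨ofAdd 10, ofAdd 0⟩, ⟨ofAdd 10, ofAdd 1⟩, ⟨ofAdd 11, ofAdd 1⟩, ⟨ofAdd 12,
  ofAdd 0⟩, ⟨ofAdd 12, ofAdd 1⟩, ⟨ofAdd 13, ofAdd 1⟩, ⟨ofAdd 14, ofAdd 0⟩, ⟨ofAdd 14, ofAdd 1⟩, ⟨ofAdd 15,
  ofAdd 1⟩}

variable {G : Type*} [Group G]

/-- **Theorem T (i), `k = 8`, `ε = −` (degree 32; kernel existence).**  `v` of order `16` with `v⁸ = c`, an involution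
`u ∉ ⟨v⟩` with `u v u⁻¹ = v⁷`: some CM type has `Φ, Φu, Φv, Φ(vu)` `SumTwo` without a conjugate pair. -/
theorem exists_twistedRectQuad_k8_neg [Fintype G] [DecidableEq G] {c : G} (hc : IsComplexConj c) (v u : G)
    (hv16 : orderOf v = 16) (hu : u ^ 2 = 1) (huv : u * v * u⁻¹ = v ^ 7) (hnot : u ∉ Subgroup.zpowers v)
    (hc8 : v ^ 8 = c) :
    ∃ Φ : Finset G, IsCMType c Φ ∧ SumTwo (fun i => rmul Φ (![1, u, v, v * u] i)) ∧
      ∀ i j : Fin 4, rmul Φ (![1, u, v, v * u] j) ≠ c • rmul Φ (![1, u, v, v * u] i) :=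
  exists_twistedRectQuad_of_model 16 hc v u (hs := seven_sq_sixteen) (by norm_num) hv16 hu
    (by rw [val_seven_sixteen]; exact huv) hnot hc8 rect8neg (by decide) (by decide) (by decide)

/-- **Theorem T (i), `k = 8`, `ε = +` (degree 32; kernel existence).**  As above with `u v u⁻¹ = v⁹`. -/
theorem exists_twistedRectQuad_k8_pos [Fintype G] [DecidableEq G] {c : G} (hc : IsComplexConj c) (v u : G)
    (hv16 : orderOf v = 16) (hu : u ^ 2 = 1) (huv : u * v * u⁻¹ = v ^ 9) (hnot : u ∉ Subgroup.zpowers v)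
    (hc8 : v ^ 8 = c) :
    ∃ Φ : Finset G, IsCMType c Φ ∧ SumTwo (fun i => rmul Φ (![1, u, v, v * u] i)) ∧
      ∀ i j : Fin 4, rmul Φ (![1, u, v, v * u] j) ≠ c • rmul Φ (![1, u, v, v * u] i) :=
  exists_twistedRectQuad_of_model 16 hc v u (hs := nine_sq_sixteen) (by norm_num) hv16 hu
    (by rw [val_nine_sixteen]; exact huv) hnot hc8 rect8pos (by decide) (by decide) (by decide)

/-! ### `k = 12`: the twisted segment of degree 48 -/

/-- `11² = 1` in `ℤ/24`. -/
theorem eleven_sq_24 : (11 : ZMod 24) * 11 = 1 := by decide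

/-- `13² = 1` in `ℤ/24`. -/
theorem thirteen_sq_24 : (13 : ZMod 24) * 13 = 1 := by decide

/-- `(11 : ℤ/24).val = 11`. -/
theorem val_eleven_24 : (11 : ZMod 24).val = 11 := by decide

/-- `(13 : ℤ/24).val = 13`. -/
theorem val_thirteen_24 : (13 : ZMod 24).val = 13 := by decide

/-- The segment `{1, v, v², u}` on a model group (the `SD` form, `w = u`). -/
def segSD (m : ℕ) [NeZero m] (s : ZMod m) (hs : s * s = 1) : Fin 4 → TwistGroup m s hs :=
  ![1, tv m s hs, tv m s hs ^ 2, tu m s hs]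

/-- The segment `{1, v, v², v⁷ u}` on a model group (the `M` form at `k = 12`, `w = v⁷ u`). -/
def segM7 (m : ℕ) [NeZero m] (s : ZMod m) (hs : s * s = 1) : Fin 4 → TwistGroup m s hs :=
  ![1, tv m s hs, tv m s hs ^ 2, tv m s hs ^ 7 * tu m s hs]

/-- Route-2's period-8 segment type on `ℤ/24 ⋊ ℤ/2`, `SD` form (`u v u⁻¹ = v¹¹`). -/
def seg12SD : Finset (TwistGroup 24 11 eleven_sq_24) :=
  {⟨ofAdd 0, ofAdd 1⟩, ⟨ofAdd 1, ofAdd 1⟩, ⟨ofAdd 2, ofAdd 0⟩, ⟨ofAdd 2, ofAdd 1⟩, ⟨ofAdd 3, ofAdd 1⟩, ⟨ofAdd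
  4, ofAdd 0⟩, ⟨ofAdd 5, ofAdd 0⟩, ⟨ofAdd 7, ofAdd 0⟩, ⟨ofAdd 8, ofAdd 1⟩, ⟨ofAdd 9, ofAdd 1⟩, ⟨ofAdd 10,
  ofAdd 0⟩, ⟨ofAdd 10, ofAdd 1⟩, ⟨ofAdd 11, ofAdd 1⟩, ⟨ofAdd 12, ofAdd 0⟩, ⟨ofAdd 13, ofAdd 0⟩, ⟨ofAdd 15,
  ofAdd 0⟩, ⟨ofAdd 16, ofAdd 1⟩, ⟨ofAdd 17, ofAdd 1⟩, ⟨ofAdd 18, ofAdd 0⟩, ⟨ofAdd 18, ofAdd 1⟩, ⟨ofAdd 19,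
  ofAdd 1⟩, ⟨ofAdd 20, ofAdd 0⟩, ⟨ofAdd 21, ofAdd 0⟩, ⟨ofAdd 23, ofAdd 0⟩}

/-- Route-2's period-8 segment type on `ℤ/24 ⋊ ℤ/2`, `M` form (`u v u⁻¹ = v¹³`). -/
def seg12M : Finset (TwistGroup 24 13 thirteen_sq_24) :=
  {⟨ofAdd 0, ofAdd 1⟩, ⟨ofAdd 2, ofAdd 0⟩, ⟨ofAdd 4, ofAdd 0⟩, ⟨ofAdd 5, ofAdd 0⟩, ⟨ofAdd 5, ofAdd 1⟩, ⟨ofAdd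
  6, ofAdd 1⟩, ⟨ofAdd 7, ofAdd 0⟩, ⟨ofAdd 7, ofAdd 1⟩, ⟨ofAdd 8, ofAdd 1⟩, ⟨ofAdd 10, ofAdd 0⟩, ⟨ofAdd 12,
  ofAdd 0⟩, ⟨ofAdd 13, ofAdd 0⟩, ⟨ofAdd 13, ofAdd 1⟩, ⟨ofAdd 14, ofAdd 1⟩, ⟨ofAdd 15, ofAdd 0⟩, ⟨ofAdd 15,
  ofAdd 1⟩, ⟨ofAdd 16, ofAdd 1⟩, ⟨ofAdd 18, ofAdd 0⟩, ⟨ofAdd 20, ofAdd 0⟩, ⟨ofAdd 21, ofAdd 0⟩, ⟨ofAdd 21,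
  ofAdd 1⟩, ⟨ofAdd 22, ofAdd 1⟩, ⟨ofAdd 23, ofAdd 0⟩, ⟨ofAdd 23, ofAdd 1⟩}

/-- The twists of `![1, v, v², u]` are the images of `segSD`. -/
theorem modelHom_segSD (m : ℕ) [NeZero m] {s : ZMod m} {hs : s * s = 1} (hm : 1 < m) (v u : G)
    (hv : v ^ m = 1) (hu : u ^ 2 = 1) (huv : u * v * u⁻¹ = v ^ s.val) (i : Fin 4) :
    modelHom m (hs := hs) v u hv hu huv (segSD m s hs i) = ![1, v, v ^ 2, u] i := by
  fin_cases i
  · exact map_one _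
  · exact modelHom_tv m hm v u hv hu huv
  · show modelHom m (hs := hs) v u hv hu huv (tv m s hs ^ 2) = v ^ 2
    rw [map_pow, modelHom_tv m hm]
  · exact modelHom_tu m v u hv hu huv

/-- The twists of `![1, v, v², v⁷ u]` are the images of `segM7`. -/
theorem modelHom_segM7 (m : ℕ) [NeZero m] {s : ZMod m} {hs : s * s = 1} (hm : 1 < m) (v u : G)
    (hv : v ^ m = 1) (hu : u ^ 2 = 1) (huv : u * v * u⁻¹ = v ^ s.val) (i : Fin 4) :
    modelHom m (hs := hs) v u hv hu huv (segM7 m s hs i) = ![1, v, v ^ 2, v ^ 7 * u] i := by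
  fin_cases i
  · exact map_one _
  · exact modelHom_tv m hm v u hv hu huv
  · show modelHom m (hs := hs) v u hv hu huv (tv m s hs ^ 2) = v ^ 2
    rw [map_pow, modelHom_tv m hm]
  · show modelHom m (hs := hs) v u hv hu huv (tv m s hs ^ 7 * tu m s hs) = v ^ 7 * u
    rw [map_mul, map_pow, modelHom_tv m hm, modelHom_tu]

/-- **Theorem S, `k = 12`, `SD` form (degree 48; kernel existence).**  `v` of order `24` with `v¹² = c`, an involution
`u ∉ ⟨v⟩` with `u v u⁻¹ = v¹¹` (`= c v⁻¹`): some CM type has the twisted segment `Φ, Φv, Φv², Φu` `SumTwo` without a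
conjugate pair. -/
theorem exists_segmentQuad_k12_SD [Fintype G] [DecidableEq G] {c : G} (hc : IsComplexConj c) (v u : G)
    (hv24 : orderOf v = 24) (hu : u ^ 2 = 1) (huv : u * v * u⁻¹ = v ^ 11) (hnot : u ∉ Subgroup.zpowers v)
    (hc12 : v ^ 12 = c) :
    ∃ Φ : Finset G, IsCMType c Φ ∧ SumTwo (fun i => rmul Φ (![1, v, v ^ 2, u] i)) ∧
      ∀ i j : Fin 4, rmul Φ (![1, v, v ^ 2, u] j) ≠ c • rmul Φ (![1, v, v ^ 2, u] i) := by
  have hv : v ^ 24 = 1 := by rw [← hv24]; exact pow_orderOf_eq_one v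
  have huv' : u * v * u⁻¹ = v ^ (11 : ZMod 24).val := by rw [val_eleven_24]; exact huv
  obtain ⟨Φ, g1, g2, g3⟩ := exists_quad_of_model 24 (modelHom 24 (hs := eleven_sq_24) v u hv hu huv')
    (modelHom_injective 24 v u hv hu huv' hv24 hnot) hc (by rw [modelHom_tc, hc12]) (segSD 24 11 eleven_sq_24)
    seg12SD (by decide) (by decide) (by decide)
  simp only [modelHom_segSD 24 (by norm_num : 1 < 24)] at g2 g3
  exact ⟨Φ, g1, g2, g3⟩

/-- **Theorem S, `k = 12`, `M` form (degree 48; kernel existence).**  `v` of order `24` with `v¹² = c`, an involution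
`u ∉ ⟨v⟩` with `u v u⁻¹ = v¹³` (`= c v`): some CM type has the twisted segment `Φ, Φv, Φv², Φw`, `w = v⁷ u`
(`w² = v²`, `w v w⁻¹ = c v`), `SumTwo` without a conjugate pair. -/
theorem exists_segmentQuad_k12_M [Fintype G] [DecidableEq G] {c : G} (hc : IsComplexConj c) (v u : G)
    (hv24 : orderOf v = 24) (hu : u ^ 2 = 1) (huv : u * v * u⁻¹ = v ^ 13) (hnot : u ∉ Subgroup.zpowers v)
    (hc12 : v ^ 12 = c) :
    ∃ Φ : Finset G, IsCMType c Φ ∧ SumTwo (fun i => rmul Φ (![1, v, v ^ 2, v ^ 7 * u] i)) ∧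
      ∀ i j : Fin 4, rmul Φ (![1, v, v ^ 2, v ^ 7 * u] j) ≠ c • rmul Φ (![1, v, v ^ 2, v ^ 7 * u] i) := by
  have hv : v ^ 24 = 1 := by rw [← hv24]; exact pow_orderOf_eq_one v
  have huv' : u * v * u⁻¹ = v ^ (13 : ZMod 24).val := by rw [val_thirteen_24]; exact huv
  obtain ⟨Φ, g1, g2, g3⟩ := exists_quad_of_model 24 (modelHom 24 (hs := thirteen_sq_24) v u hv hu huv')
    (modelHom_injective 24 v u hv hu huv' hv24 hnot) hc (by rw [modelHom_tc, hc12]) (segM7 24 13 thirteen_sq_24)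
    seg12M (by decide) (by decide) (by decide)
  simp only [modelHom_segM7 24 (by norm_num : 1 < 24)] at g2 g3
  exact ⟨Φ, g1, g2, g3⟩

/-! ### The models themselves -/

/-- `v` has order 16 in the `k = 8`, `ε = −` model. -/
theorem orderOf_tv_16_7 : orderOf (tv 16 7 seven_sq_sixteen) = 16 := by
  rw [orderOf_eq_iff (by norm_num)]
  exact ⟨by decide, by decide⟩

/-- `v` has order 16 in the `k = 8`, `ε = +` model. -/
theorem orderOf_tv_16_9 : orderOf (tv 16 9 nine_sq_sixteen) = 16 := by
  rw [orderOf_eq_iff (by norm_num)]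
  exact ⟨by decide, by decide⟩

/-- `v` has order 24 in the `k = 12`, `SD` model. -/
theorem orderOf_tv_24_11 : orderOf (tv 24 11 eleven_sq_24) = 24 := by
  rw [orderOf_eq_iff (by norm_num)]
  exact ⟨by decide, by decide⟩

/-- `v` has order 24 in the `k = 12`, `M` model. -/
theorem orderOf_tv_24_13 : orderOf (tv 24 13 thirteen_sq_24) = 24 := by
  rw [orderOf_eq_iff (by norm_num)]
  exact ⟨by decide, by decide⟩

/-- The degree-32 twisted rectangle, `ε = −`, on its model. -/
theorem exists_twistedRectQuad_on_16_7 : ∃ Φ : Finset (TwistGroup 16 7 seven_sq_sixteen),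
    IsCMType (tc 16 7 seven_sq_sixteen) Φ ∧ SumTwo (fun i => rmul Φ (rectT 16 7 seven_sq_sixteen i)) ∧
    ∀ i j : Fin 4, rmul Φ (rectT 16 7 seven_sq_sixteen j) ≠
      tc 16 7 seven_sq_sixteen • rmul Φ (rectT 16 7 seven_sq_sixteen i) :=
  exists_twistedRectQuad_k8_neg ⟨by decide, by decide, by decide⟩ _ _ orderOf_tv_16_7 (by decide) (by decide)
    (tu_not_mem_zpowers _ _ _) (by decide)

/-- The degree-32 twisted rectangle, `ε = +`, on its model. -/
theorem exists_twistedRectQuad_on_16_9 : ∃ Φ : Finset (TwistGroup 16 9 nine_sq_sixteen),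
    IsCMType (tc 16 9 nine_sq_sixteen) Φ ∧ SumTwo (fun i => rmul Φ (rectT 16 9 nine_sq_sixteen i)) ∧
    ∀ i j : Fin 4, rmul Φ (rectT 16 9 nine_sq_sixteen j) ≠
      tc 16 9 nine_sq_sixteen • rmul Φ (rectT 16 9 nine_sq_sixteen i) :=
  exists_twistedRectQuad_k8_pos ⟨by decide, by decide, by decide⟩ _ _ orderOf_tv_16_9 (by decide) (by decide)
    (tu_not_mem_zpowers _ _ _) (by decide)

/-- The degree-48 twisted segment, `SD` form, on its model. -/
theorem exists_segmentQuad_on_24_11 : ∃ Φ : Finset (TwistGroup 24 11 eleven_sq_24),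
    IsCMType (tc 24 11 eleven_sq_24) Φ ∧ SumTwo (fun i => rmul Φ (segSD 24 11 eleven_sq_24 i)) ∧
    ∀ i j : Fin 4, rmul Φ (segSD 24 11 eleven_sq_24 j) ≠
      tc 24 11 eleven_sq_24 • rmul Φ (segSD 24 11 eleven_sq_24 i) :=
  exists_segmentQuad_k12_SD ⟨by decide, by decide, by decide⟩ _ _ orderOf_tv_24_11 (by decide) (by decide)
    (tu_not_mem_zpowers _ _ _) (by decide)

/-- The degree-48 twisted segment, `M` form, on its model. -/
theorem exists_segmentQuad_on_24_13 : ∃ Φ : Finset (TwistGroup 24 13 thirteen_sq_24),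
    IsCMType (tc 24 13 thirteen_sq_24) Φ ∧ SumTwo (fun i => rmul Φ (segM7 24 13 thirteen_sq_24 i)) ∧
    ∀ i j : Fin 4, rmul Φ (segM7 24 13 thirteen_sq_24 j) ≠
      tc 24 13 thirteen_sq_24 • rmul Φ (segM7 24 13 thirteen_sq_24 i) :=
  exists_segmentQuad_k12_M ⟨by decide, by decide, by decide⟩ _ _ orderOf_tv_24_13 (by decide) (by decide)
    (tu_not_mem_zpowers _ _ _) (by decide)

end HodgeRepro.TwistedQuadGen
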